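import Literature.Geometry.Lorentzian.KerrSchild
import HarnessLib

/-!
# The Kerr–Schild radius is `1`-Lipschitz in the squared spin

Topic `Literature/Geometry/Lorentzian` (namespace `Literature.Geometry.Lorentzian.Kerr`). The
Kerr–Schild radius `r = r(a, x)` of a point `x ∈ ℝ⁴` is the nonnegative root of
`r⁴ − (ρ² − a²) r² − a² z² = 0`, i.e. `r² = ((ρ² − a²) + √((ρ² − a²)² + 4 a² z²)) / 2`
(Visser, arXiv:0706.0622, (35); the tree's `Kerr.radius`, `Kerr.radius_sq`). As a function of the
squared spin `s = a²` (at fixed `x`) the right-hand side is `1`-Lipschitz, because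
`|2 z² − (ρ² − s)| ≤ √((ρ² − s)² + 4 s z²)` when `z² ≤ ρ²`. Consequently two Kerr–Schild radii of
the same point, painted with different spins, satisfy `|r² − r'²| ≤ |a² − a'²|`
(`abs_radius_sq_sub_radius_sq_le`) and `|r − r'| ≤ |a² − a'²| / ρ` whenever `ρ ≤ r + r'`
(`abs_radius_sub_radius_le_div`, `abs_radius_sub_radius_le_div_of_le`). Elementary algebra on
Visser's formula; no definitions.

## References

* M. Visser, *The Kerr spacetime: a brief introduction*, arXiv:0706.0622, eq. (35). [cite: arXiv07060622]
-/

namespace Literature.Geometry.Lorentzian.Kerr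

/-- `|2 z² − (P − s)| ≤ √((P − s)² + 4 s z²)` for `z² ≤ P`: the square of the left-hand side is
the radicand minus `4 z² (P − z²) ≥ 0` (Visser arXiv:0706.0622, (35)). [cite: arXiv07060622, (35)] -/
theorem abs_two_mul_sq_sub_le_sqrt {P s z : ℝ} (hz : z ^ 2 ≤ P) :
    |2 * z ^ 2 - (P - s)| ≤ √((P - s) ^ 2 + 4 * s * z ^ 2) := by
  rw [← Real.sqrt_sq_eq_abs]
  exact Real.sqrt_le_sqrt (by nlinarith [mul_nonneg (sq_nonneg z) (sub_nonneg.2 hz)])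

/-- **The squared Kerr–Schild radius is `1`-Lipschitz in the squared spin**:
`|r(a, x)² − r(a', x)²| ≤ |a² − a'²|` for every point `x` (Visser arXiv:0706.0622, (35):
`2 r² = q + √(q² + 4 a² z²)`, `q = ρ² − a²`, and `|2 z² − q| ≤ √(q² + 4 a² z²)`). [cite: arXiv07060622, (35)] -/
theorem abs_radius_sq_sub_radius_sq_le (a a' : ℝ) (x : E4) :
    |radius a x ^ 2 - radius a' x ^ 2| ≤ |a ^ 2 - a' ^ 2| := by
  have hz : x 3 ^ 2 ≤ E4.spatialNorm x ^ 2 := by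
    rw [E4.spatialNorm_sq]
    nlinarith [sq_nonneg (x 1), sq_nonneg (x 2)]
  have hD : 0 ≤ (E4.spatialNorm x ^ 2 - a ^ 2) ^ 2 + 4 * a ^ 2 * x 3 ^ 2 := by positivity
  have hD' : 0 ≤ (E4.spatialNorm x ^ 2 - a' ^ 2) ^ 2 + 4 * a' ^ 2 * x 3 ^ 2 := by positivity
  set D := (E4.spatialNorm x ^ 2 - a ^ 2) ^ 2 + 4 * a ^ 2 * x 3 ^ 2 with hDdef
  set D' := (E4.spatialNorm x ^ 2 - a' ^ 2) ^ 2 + 4 * a' ^ 2 * x 3 ^ 2 with hD'def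
  have h1 : |2 * x 3 ^ 2 - (E4.spatialNorm x ^ 2 - a ^ 2)| ≤ √D :=
    abs_two_mul_sq_sub_le_sqrt hz
  have h2 : |2 * x 3 ^ 2 - (E4.spatialNorm x ^ 2 - a' ^ 2)| ≤ √D' :=
    abs_two_mul_sq_sub_le_sqrt hz
  have hDD : D - D' = (a ^ 2 - a' ^ 2) *
      ((2 * x 3 ^ 2 - (E4.spatialNorm x ^ 2 - a ^ 2)) +
        (2 * x 3 ^ 2 - (E4.spatialNorm x ^ 2 - a' ^ 2))) := by
    rw [hDdef, hD'def]; ring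
  -- the inner square roots are `|a² − a'²|`-close
  have key : |√D - √D'| ≤ |a ^ 2 - a' ^ 2| := by
    rcases (add_nonneg (Real.sqrt_nonneg D) (Real.sqrt_nonneg D')).eq_or_lt with h0 | hpos
    · have e1 : √D = 0 := by linarith [Real.sqrt_nonneg D, Real.sqrt_nonneg D']
      have e2 : √D' = 0 := by linarith [Real.sqrt_nonneg D, Real.sqrt_nonneg D']
      rw [e1, e2, sub_zero, abs_zero]
      exact abs_nonneg _
    · have e : √D - √D' = (D - D') / (√D + √D') := by
        rw [eq_div_iff hpos.ne']
        nlinarith [Real.mul_self_sqrt hD, Real.mul_self_sqrt hD']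
      rw [e, abs_div, abs_of_pos hpos, div_le_iff₀ hpos, hDD, abs_mul]
      exact mul_le_mul_of_nonneg_left ((abs_add_le _ _).trans (add_le_add h1 h2)) (abs_nonneg _)
  rw [radius_sq, radius_sq]
  have e : (E4.spatialNorm x ^ 2 - a ^ 2 + √D) / 2 - (E4.spatialNorm x ^ 2 - a' ^ 2 + √D') / 2 =
      ((a' ^ 2 - a ^ 2) + (√D - √D')) / 2 := by ring
  rw [e, abs_div, abs_two]
  have h3 : |a' ^ 2 - a ^ 2| = |a ^ 2 - a' ^ 2| := abs_sub_comm _ _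
  linarith [abs_add_le (a' ^ 2 - a ^ 2) (√D - √D')]

/-- **Two Kerr–Schild radii of one point are close when the spins are**: if `0 < ρ ≤ r + r'` then
`|r(a, x) − r(a', x)| ≤ |a² − a'²| / ρ` (divide `|r² − r'²| ≤ |a² − a'²|` by `r + r'`;
Visser arXiv:0706.0622, (35)). [cite: arXiv07060622, (35)] -/
theorem abs_radius_sub_radius_le_div (a a' : ℝ) (x : E4) {ρ : ℝ} (hρ : 0 < ρ)
    (h : ρ ≤ radius a x + radius a' x) :
    |radius a x - radius a' x| ≤ |a ^ 2 - a' ^ 2| / ρ := by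
  rw [le_div_iff₀ hρ]
  have e : radius a x ^ 2 - radius a' x ^ 2 =
      (radius a x - radius a' x) * (radius a x + radius a' x) := by ring
  calc |radius a x - radius a' x| * ρ
      ≤ |radius a x - radius a' x| * (radius a x + radius a' x) :=
        mul_le_mul_of_nonneg_left h (abs_nonneg _)
    _ = |radius a x ^ 2 - radius a' x ^ 2| := by rw [e, abs_mul, abs_of_pos (hρ.trans_le h)]
    _ ≤ |a ^ 2 - a' ^ 2| := abs_radius_sq_sub_radius_sq_le a a' x

/-- One-sided form: if one of the two radii is at least `ρ > 0`, then
`|r(a, x) − r(a', x)| ≤ |a² − a'²| / ρ` (the other radius is nonnegative;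
Visser arXiv:0706.0622, (35)). [cite: arXiv07060622, (35)] -/
theorem abs_radius_sub_radius_le_div_of_le (a a' : ℝ) (x : E4) {ρ : ℝ} (hρ : 0 < ρ)
    (h : ρ ≤ radius a' x) : |radius a x - radius a' x| ≤ |a ^ 2 - a' ^ 2| / ρ :=
  abs_radius_sub_radius_le_div a a' x hρ (h.trans (le_add_of_nonneg_left (radius_nonneg a x)))

end Literature.Geometry.Lorentzian.Kerr
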